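import Summits.BirchSwinnertonDyer.BirchSwinnertonDyer.Theorems.RamifiedSevenEllipticUnitsStrictTorsionOfControl
import Summits.BirchSwinnertonDyer.BirchSwinnertonDyer.Theorems.RamifiedSevenEllipticUnitsSevenTorsionLocal
import Summits.BirchSwinnertonDyer.BirchSwinnertonDyer.Theorems.RamifiedSevenEllipticUnitsStrictControlDescent
import Summits.BirchSwinnertonDyer.BirchSwinnertonDyer.Theorems.RamifiedSevenEllipticUnitsIndexIffControl
import Summits.BirchSwinnertonDyer.Rank1Residual.Additive.QuadraticBranchOddStrictSelmer
import Literature.NumberTheory.EllipticCurves.ComplexMultiplicationLFunctionIsogenyHoldsProofs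
import Literature.NumberTheory.EllipticCurves.LeadingTerm
import HarnessLib

set_option linter.dupNamespace false
set_option autoImplicit false

/-!
# Route `RamifiedSevenEllipticUnits` (rung K7r), crux `StrictTorsionSeven` (stmt-BirchSwinnertonDyer-19144):
# (R-tors)@7 on 𝒞₇ rests on ONE input — finiteness of `Sel_𝔭(K, W[7^∞])` — and, under
# Gross–Zagier–Kolyvagin, on the finiteness shadow of crux #4's descent identity

Cell `bsd-cm`, seat `bsd-cm-k7r-c3` (D-0074). HONEST FRAMING: nothing here closes the crux; BSD is
not proved by any of this. This file composes what the K7r hands have put in the kernel: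

* the seat's reduction `strictTorsionSeven_of_finite_invariants` (`…StrictTorsionOfControl`: in
  analytic rank one, (R-tors) needs no Euler system — `Sel^Γ` finite ⟹ torsion, `f(0) ≠ 0`, `X[T]`
  finite), and k7r-c4's exact control with BOTH local inputs discharged for 𝒞₇
  (`strictControl_frame_finite_iff_of_classCSeven`: `Sel^Γ` finite ⟺ `Sel_𝔭(K, W[7^∞])` finite);
* independently, the seat's own local theorem at the ramified prime
  (`SevenTorsion.seven_nsmul_adicCompletion_eq_zero_of_isFrame`, by the explicit `7`-division
  polynomial — valid for every `K` with `e(𝔭|7) ≤ 2`) with k7r-c4's away-from-`7` input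
  `good_or_noSevenTorsion_of_classCSeven`, giving the same reduction by a second route;
* Gross–Zagier–Kolyvagin (the named fact `rank_eq_analyticRank_of_analyticRank_le_one`) and the
  tree's `finite_strictSelmerPInfty_of_mordellWeilRank_eq_one`: at a frame of analytic rank one BOTH
  `Sel_str(W/ℚ)[7^∞]` and `Sel_str(W'/ℚ)[7^∞]` are finite (`W'` is isogenous to `W`, so also of
  analytic rank one).

RESULT. `StrictTorsionSeven` ⟸ (F) `Finite Sel_𝔭(K, W[7^∞])` at every analytic-rank-one frame of
every `W ∈ 𝒞₇` (`strictTorsionSeven_of_finite_base`); and ⟸ GZK ∧ (DescFin), where (DescFin) —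
"`Sel_str(W/ℚ)[7^∞]`, `Sel_str(W'/ℚ)[7^∞]` finite ⟹ `Sel_𝔭(K, W[7^∞])` finite" — is the finiteness
shadow of crux #4's descent identity (D) (`strictTorsionSeven_of_GZK_of_descentFinite`). No
`Λ`-module, no Euler system, no local `7`-adic input remains in crux #3.

References: [GreenbergLNM1716] §1 p. 61, §3 Thm. 1.2, Lemmas 3.1–3.3; [SilvermanAEC2009] Exercise
3.7; [Skinner2020] §2.2; [GrossZagier1986], [Kolyvagin1990] (the named fact);
[BurungaleKobayashiNakamuraOta2026] Prop. 3.7 (2), (3.16) (arXiv:2608.06879; made unnecessary for 𝒞₇).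
-/

noncomputable section

open scoped Classical

open WeierstrassCurve NumberField IsDedekindDomain Field
  Literature.NumberTheory.EllipticCurves
  Summit.BirchSwinnertonDyer.Rank1Residual
  Summit.BirchSwinnertonDyer.Rank1Residual.X11b.AcSelmer

namespace Summit.BirchSwinnertonDyer.BirchSwinnertonDyer.Theorems.RamifiedSevenEllipticUnits

/-! ## §1 Crux #3 from the single input (F) -/

/-- **`StrictTorsionSeven` from (F) alone**: if at every O11 frame `(K, 𝔭, W', C)` at `7` of every
globally minimal `W ∈ 𝒞₇` of analytic rank one Castella's strict Selmer group `Sel_𝔭(K, W[7^∞])` is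
finite, then (R-tors)@7 holds on 𝒞₇. (Exact control with both local inputs discharged, k7r-c4, turns
(F) into finiteness of `Sel_𝔭(K_∞, W[7^∞])^Γ`; the seat's `…_of_finite_invariants` does the rest.)
[cite: GreenbergLNM1716, §1 p. 61, §3 Thm. 1.2 and Lemmas 3.1–3.3] -/
theorem strictTorsionSeven_of_finite_base
    (hfin : ∀ (W : WeierstrassCurve ℚ) [W.IsElliptic] [W.IsGloballyMinimal] [Fact (Nat.Prime 7)],
      X12.ClassCSeven W →
      ∀ (K : Type) [Field K] [NumberField K] (𝔭 : HeightOneSpectrum (𝓞 K))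
        (W' : WeierstrassCurve ℚ) [W'.IsElliptic] [W'.IsGloballyMinimal] (C : VariableChange ℚ),
        X12.O11.IsFrame W 7 K 𝔭 W' C → W.analyticRank = 1 →
        Finite (selmerAcBase (W.baseChange K) 7 𝔭 ∅)) :
    Summit.BirchSwinnertonDyer.BirchSwinnertonDyer.Theses.RamifiedSevenEllipticUnits.StrictTorsionSeven :=
  strictTorsionSeven_of_finite_invariants fun W _ _ _ hC K _ _ 𝔭 W' _ _ C hF h1 κ _ γ _ ↦
    (strictControl_frame_finite_iff_of_classCSeven hC hF κ γ).mpr (hfin W hC K 𝔭 W' C hF h1)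

/-- The same by the SECOND route for the local input at `𝔭`: the seat's division-polynomial theorem
`SevenTorsion.seven_nsmul_adicCompletion_eq_zero_of_isFrame` for (A𝔭) and k7r-c4's
`good_or_noSevenTorsion_of_classCSeven` for (Av), fed to `strictTorsionSeven_of_noPTorsion_of_finite_base`.
[cite: SilvermanAEC2009, Exercise 3.7] [cite: GreenbergLNM1716, §3 Lemmas 3.1–3.3] -/
theorem strictTorsionSeven_of_finite_base'
    (hfin : ∀ (W : WeierstrassCurve ℚ) [W.IsElliptic] [W.IsGloballyMinimal] [Fact (Nat.Prime 7)],
      X12.ClassCSeven W →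
      ∀ (K : Type) [Field K] [NumberField K] (𝔭 : HeightOneSpectrum (𝓞 K))
        (W' : WeierstrassCurve ℚ) [W'.IsElliptic] [W'.IsGloballyMinimal] (C : VariableChange ℚ),
        X12.O11.IsFrame W 7 K 𝔭 W' C → W.analyticRank = 1 →
        Finite (selmerAcBase (W.baseChange K) 7 𝔭 ∅)) :
    Summit.BirchSwinnertonDyer.BirchSwinnertonDyer.Theses.RamifiedSevenEllipticUnits.StrictTorsionSeven :=
  strictTorsionSeven_of_noPTorsion_of_finite_base
    (fun W _ _ _ hC _ _ _ 𝔭 W' _ _ C hF ↦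
      SevenTorsion.seven_nsmul_adicCompletion_eq_zero_of_isFrame W hC 𝔭 W' C hF)
    (fun W _ _ _ hC _ _ _ _ _ _ _ _ hF ↦ good_or_noSevenTorsion_of_classCSeven W hC hF)
    hfin

/-! ## §2 Under Gross–Zagier–Kolyvagin the `ℚ`-side strict Selmer groups at a frame are finite -/

/-- **GZK ⟹ `Sel_str(W/ℚ)[p^∞]` finite in analytic rank one.** From the named fact
`rank_eq_analyticRank_of_analyticRank_le_one` (`rank = r_an` and `Ш` finite for `r_an ≤ 1`) and the
tree's `finite_strictSelmerPInfty_of_mordellWeilRank_eq_one`. CONDITIONAL on the named fact (taken as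
a hypothesis). [cite: Skinner2020, §2.2] [cite: Kolyvagin1990, Thm. A] -/
theorem finite_strictSelmerPInfty_of_GZK (hGZK : rank_eq_analyticRank_of_analyticRank_le_one)
    (W : WeierstrassCurve ℚ) [W.IsElliptic] (p : ℕ) [Fact p.Prime] (h1 : W.analyticRank = 1) :
    Finite ↥(Additive.strictSelmerPInfty W p) := by
  obtain ⟨hrank, hsha⟩ := hGZK W h1.le
  rw [h1] at hrank
  haveI : Finite W.sha := hsha
  haveI : Finite (AddCommGroup.primaryComponent W.sha p) := inferInstance
  exact Additive.finite_strictSelmerPInfty_of_mordellWeilRank_eq_one W p hrank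

/-- **At a frame both twins are finite under GZK**: `W'` is isogenous to `W`
(`isIsogenous_of_isFrame`), so `r_an(W') = r_an(W) = 1` (`analyticRank_eq_of_isIsogenous'`).
[cite: Skinner2020, §2.2] [cite: Kolyvagin1990, Thm. A] -/
theorem finite_strictSelmerPInfty_frame_of_GZK (hGZK : rank_eq_analyticRank_of_analyticRank_le_one)
    (W : WeierstrassCurve ℚ) [W.IsElliptic] [W.IsGloballyMinimal] [Fact (Nat.Prime 7)]
    {K : Type} [Field K] [NumberField K] {𝔭 : HeightOneSpectrum (𝓞 K)}
    {W' : WeierstrassCurve ℚ} [W'.IsElliptic] [W'.IsGloballyMinimal] {C : VariableChange ℚ}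
    (hF : X12.O11.IsFrame W 7 K 𝔭 W' C) (h1 : W.analyticRank = 1) :
    Finite ↥(Additive.strictSelmerPInfty W 7) ∧ Finite ↥(Additive.strictSelmerPInfty W' 7) := by
  have h1' : W'.analyticRank = 1 := by
    rw [← analyticRank_eq_of_isIsogenous' (isIsogenous_of_isFrame hF), h1]
  exact ⟨finite_strictSelmerPInfty_of_GZK hGZK W 7 h1, finite_strictSelmerPInfty_of_GZK hGZK W' 7 h1'⟩

/-! ## §3 Crux #3 under GZK from the finiteness shadow of the descent identity -/

/-- **`StrictTorsionSeven` ⟸ GZK ∧ (DescFin).** Under Gross–Zagier–Kolyvagin, (R-tors)@7 on 𝒞₇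
follows from the finiteness shadow of crux #4's descent identity: at every frame, finiteness of the
two `ℚ`-side strict Selmer groups `Sel_str(W/ℚ)[7^∞]`, `Sel_str(W'/ℚ)[7^∞]` implies finiteness of
Castella's `Sel_𝔭(K, W[7^∞])`. CONDITIONAL on the named fact `rank_eq_analyticRank_of_analyticRank_le_one`
(hypothesis `hGZK`) and on (DescFin) (hypothesis `hdesc`, k7r-c4's (D) in finiteness form).
[cite: GreenbergLNM1716, §1 p. 61 and §3 Thm. 1.2] [cite: Skinner2020, §2.2] -/
theorem strictTorsionSeven_of_GZK_of_descentFinite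
    (hGZK : rank_eq_analyticRank_of_analyticRank_le_one)
    (hdesc : ∀ (W : WeierstrassCurve ℚ) [W.IsElliptic] [W.IsGloballyMinimal] [Fact (Nat.Prime 7)],
      X12.ClassCSeven W →
      ∀ (K : Type) [Field K] [NumberField K] (𝔭 : HeightOneSpectrum (𝓞 K))
        (W' : WeierstrassCurve ℚ) [W'.IsElliptic] [W'.IsGloballyMinimal] (C : VariableChange ℚ),
        X12.O11.IsFrame W 7 K 𝔭 W' C →
        Finite ↥(Additive.strictSelmerPInfty W 7) → Finite ↥(Additive.strictSelmerPInfty W' 7) →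
        Finite (selmerAcBase (W.baseChange K) 7 𝔭 ∅)) :
    Summit.BirchSwinnertonDyer.BirchSwinnertonDyer.Theses.RamifiedSevenEllipticUnits.StrictTorsionSeven :=
  strictTorsionSeven_of_finite_base fun W _ _ _ hC K _ _ 𝔭 W' _ _ C hF h1 ↦ by
    obtain ⟨hW, hW'⟩ := finite_strictSelmerPInfty_frame_of_GZK hGZK W hF h1
    exact hdesc W hC K 𝔭 W' C hF hW hW'

end Summit.BirchSwinnertonDyer.BirchSwinnertonDyer.Theorems.RamifiedSevenEllipticUnits

end
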